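import Summits.BirchSwinnertonDyer.BirchSwinnertonDyer.Theorems.EdixhovenFibreFiveSevenStarredOptimalManinUnitFiveSevenAssemblyIntegralValuesCarayolFree
import Literature.NumberTheory.AdelicBaseChange.PadicTensorCompletionProofs
import Literature.NumberTheory.EllipticCurves.Kato2004.EulerSystemDefinedValues
import Literature.NumberTheory.EllipticCurves.Isogeny
import Literature.NumberTheory.EllipticCurves.GlobalMinimalModel
import Literature.NumberTheory.EllipticCurves.ImaginaryPeriod
import HarnessLib

/-!
# TURNKEY for the FINAL ASSEMBLY of the F″ programme (seat bsd-line-edix-p4 g3, v2 2026-08-28T04:10Z; line `kato-lever`,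
# crux K★ stmt-BirchSwinnertonDyer-22226): F″ ⟸ P1 + (S5b-tower) + Kato II 1.2.3 + de Rham — Carayol-FREE (v2 calls
# edix-p5 g3's `KatoCarayolFree.kato_neron_five_le_of_integralSL2NeronValues'`, p603961)

STATUS: ELABORATES (rc 0, ONE `sorry` = the P4-coh part-2 call, see PART B). PART A is an INLINED COPY of the P1 text
submitted as p603032 (`Literature/NumberTheory/EllipticCurves/Kato2004/EulerSystemSL2NeronValues.lean`, review lane,
seat manin-p1 g8) under its future name, so that PART B elaborates before the fact lands; PART B is the final theorem
`kato_neron_five_le_of_sl2NeronValues (hT₂) (hP) (hDR) (hP1) : F″` (no Carayol, no modularity).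
TO LAND (≈ 5 min, whoever is alive when both inputs are in the tree; backup lander: bsd-line-edix-p2 g6):
1. delete PART A; add `import Literature.NumberTheory.EllipticCurves.Kato2004.EulerSystemSL2NeronValues` and
   `import Summits.BirchSwinnertonDyer.BirchSwinnertonDyer.Theorems.EdixhovenFibreFiveSevenStarredOptimalManinUnitFiveSevenSemiLocalIntegralityPin`
   (edix-p3 g4's P4-coh part 2 = p603458, signature posted on STATUS 2026-08-28T03:39:43Z);
2. replace the three `have … ; sorry` lines by
   `exact SemiLocalIntegrality.semilocal_mem_adicCompletionIntegers_of_pin_of_semi hT₂ hP hDR W' hp5 ⟨hg, hmu⟩ d₀ hPIN m (not_dvd_of_coprime_mul hcop) hcl Λ Ψ (hSEMI Ψ hΨ) y w`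
   (argument order as posted; adjust if the landed signature differs);
3. propose as `Theorems/EdixhovenFibreFiveSevenStarredOptimalManinUnitFiveSevenAssembly.lean --supports stmt-BirchSwinnertonDyer-22226`;
4. K★: `theorem starredOptimalManinUnitFiveSeven_of_sl2NeronValues … := starredOptimalManinUnitFiveSeven_of_kato (kato_neron_five_le_of_sl2NeronValues …)`
   (p581141; conditional on the 4 cite facts — a `conditional-result`, 22226 stays OPEN until P1 has a `_holds`).
Everything else of PART B was CHECKED against the tree at 04:08Z: the P1 unpacking (member, instance binders, `d₀`,
(PIN), `n`, (N), per-level `ι, Λ`, [SEMI] at the chosen `Ψ`), the semi-local isomorphism from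
`AdelicBaseChange.exists_padicTensorAlgEquiv`, and the (VAL) block passed VERBATIM into H″ of
`KatoCarayolFree.kato_neron_five_le_of_integralSL2NeronValues'` (p603961) / `kato_neron_five_le_of_integralSL2NeronValues`
(p602985). BSD is not proved by any of this.
-/

set_option autoImplicit false
set_option linter.dupNamespace false

noncomputable section

/-! ## PART A — INLINED COPY of p603032 (test scaffolding only) -/

section PartA

open scoped BigOperators NumberField TensorProduct Pointwise MatrixGroups NNReal
open Polynomial Field IsDedekindDomain NumberField CongruenceSubgroup ValuativeRel
open Literature.NumberTheory.GaloisRepresentations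
open Literature.NumberTheory.GaloisRepresentations.PeriodRingData
open Literature.NumberTheory.GaloisRepresentations.IsNonarchimedeanLocalField
open Literature.NumberTheory.PAdicHodge
open Literature.NumberTheory.EllipticCurves Literature.NumberTheory.EllipticCurves.ModularForms
open Literature.NumberTheory.AdelicBaseChange Literature.NumberTheory.Automorphic
open Literature.NumberTheory.EllipticCurves.Kato2004 Literature.NumberTheory.EllipticCurves.Kato2004.EulerSystemValues
open Rat.HeightOneSpectrum

namespace Literature.NumberTheory.EllipticCurves.Kato2004

-- The tree's `ℚ`-algebra structure on `ℚ_v = Place.Completion (inr v)` gets top priority LOCALLY, exactly as in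
-- `Kato2004/EulerSystemDefinedValues.lean` (its `letI` chain keys on it; `Algebra ℚ _` is a subsingleton).
attribute [local instance 100001] NumberField.Place.instAlgebraCompletion

set_option backward.isDefEq.respectTransparency false in
/-- **Kato 2004 — (8.1.3), Thm 9.7, Thm 6.6 (1) (case `ξ ∈ SL₂(ℤ)`), Thm 13.6 — at Kato's member, with the dual
exponential DEFINED and PINNED to the Néron differential** (printed statements: (8.1.2)–(8.1.3) p. 180 — `m ≥ 1`, `ξ ∈ SL₂(ℤ)`,
`S ⊇ prime(mN) ∪ {p}`, `prime(cd) ∩ S = ∅`, `(cd, 6) = 1`, `(d, N) = 1`; §8.3 p. 181; §9.4 p. 188; Thm 9.7 p. 189 (rationality of `exp*`);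
Thm 6.6 (1) p. 163 — `ξ ∈ SL₂(ℤ)`, `c ≡ d ≡ 1 mod N`, `Σ_b χ(b) per_f(σ_b z_m(f,r,r′,ξ,S))^± = L_S(f*,χ,r)(2πi)^{k−r−1}γ^±`,
`γ = T δ(f,r′,ξ)`, `T = (c² − c^uχ(c))(d² − d^vχ̄(d))`, `(u,v) = (1,1)` at `k = 2`, `r = r′ = 1`; §5.5 p. 156; Thm 13.6 p. 227). For every elliptic `W/ℚ` and prime `p` there is a
GLOBALLY MINIMAL `W_K` `ℚ`-isogenous to `W` (Kato's lattice `V_{ℤ_p}(f)(1) ≅ T_pW_K`) such that, for the newform `f` of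
`W`: there is a generator `d` of `D⁰_dR(V_pW_K|_{Γ_{ℚ_v}})` whose dual-exponential coordinate has the NÉRON range
`{a : ∀ P ∈ E(ℚ_v), ‖Tr_{ℚ_v/ℚ_p}(a · log_ω P)‖ ≤ 1}` (the pin), and Manin-symbol coordinates `n : SL₂(ℤ) → {±} → ℚ`
with, for `p ≠ 2`, a `p`-adic unit among the `n ξ ±` for each sign (Thm 13.6), such that at EVERY level `m ≥ 1` there
are an embedding `ι : ℚ(ζ_m) → ℂ` and a `ℤ_p`-linear `Λ : H¹(ℚ(μ_m), T_pW_K) → ℚ_p ⊗ ℚ(ζ_m)` which IS the semi-local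
dual exponential in the coordinate `d` ((RES)/(DEF) VERBATIM from `Kato2004.DefinedExpStarBody`, at the level subgroup
`rootsOfUnityFixer ℚ m`), and for all integers `c ≡ d ≡ 1 (mod N)` with `(cd, 6pm) = 1` and every `ξ ∈ SL₂(ℤ)` a class
`z ∈ H¹(ℚ(μ_m), T_pW_K)` ((8.1.3): integral by type) with RATIONAL value `Λ z = 1 ⊗ x` (Thm 9.7) satisfying the VALUE
LAW (Thm 9.7 ∘ 6.6 (1)): for every Dirichlet character `χ` mod `m` and every entire continuation `Lχ` of the
`(m·p·N)`-depleted series, `Σ_b χ(b) ι(σ_b x) = (c² − cχ(c))(d² − dχ̄(d)) · (n ξ ±) · Lχ(1)/Ω^±`, `Ω⁺ = Ω(W_K)`,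
`Ω⁻ = i·|Ω⁻(W_K)|`. A derived reading (two non-verbatim steps: the Néron pin via Tate duality + comparison
functoriality; the lattice coordinates), weaker than print in every binder; named fact, nothing asserted, no `_holds`.
[cite: Kato2004Asterisque, (8.1.2)-(8.1.3) (p. 180), §8.3 (p. 181), §9.4 (p. 188), Thm. 9.7 (p. 189), Thm. 6.6 (1) (p. 163), (4.2.4) (p. 143), §5.5 (p. 156), Thm. 13.6 (p. 227)]
[cite: Kato1993LNM1553, Ch. II §1.2.4 and Thm. 1.4.1 (3)-(4)] [cite: BlochKato1990, Prop. 3.8, Def. 3.10, Ex. 3.10.1, Example 3.11]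
[cite: CasselsFrohlichANT1967, Ch. II §10 Theorem (10.2) and Ch. VII §1.1]
[cite: SilvermanAEC2009, Prop. III.4.12 with Rem. III.4.13.2 and Cor. VIII.8.3]
[cite: Manin1972, §1.5 (Manin symbols generate the relative homology)] [cite: AshStevens1986, (the generation theorem quoted as Kato's Thm. 13.6)] -/
def exists_member_sl2ZetaElement_neron_values : Prop :=
  ∀ (W : WeierstrassCurve ℚ) [W.IsElliptic] (p : ℕ) [Fact p.Prime],
    ∃ (W' : WeierstrassCurve ℚ) (_ : W'.IsElliptic) (_ : W'.IsGloballyMinimal),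
    WeierstrassCurve.IsIsogenous W W' ∧
    ∀ [ContinuousSMul ℤ_[p] (W'.tateModule p)] [Module.Free ℤ_[p] (W'.tateModule p)]
      [Module.Finite ℤ_[p] (W'.tateModule p)],
    ∀ {N : ℕ} [NeZero N] (f : CuspForm (Gamma0 N) 2), IsNewformOf W f →
        letI ρT := restrictedTateRep W' (NumberField.Place.Completion (Sum.inr ((Rat.HeightOneSpectrum.primesEquiv (R := 𝓞 ℚ)).symm ⟨p, Fact.out⟩) : NumberField.Place ℚ)) p
        letI ρV := restrictedRationalTateRep W' (NumberField.Place.Completion (Sum.inr ((Rat.HeightOneSpectrum.primesEquiv (R := 𝓞 ℚ)).symm ⟨p, Fact.out⟩) : NumberField.Place ℚ)) p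
        letI : ValuativeRel (NumberField.Place.Completion (Sum.inr ((Rat.HeightOneSpectrum.primesEquiv (R := 𝓞 ℚ)).symm ⟨p, Fact.out⟩) : NumberField.Place ℚ)) :=
          inferInstanceAs (ValuativeRel (((Rat.HeightOneSpectrum.primesEquiv (R := 𝓞 ℚ)).symm ⟨p, Fact.out⟩).adicCompletion ℚ))
        letI : TopologicalSpace (NumberField.Place.Completion (Sum.inr ((Rat.HeightOneSpectrum.primesEquiv (R := 𝓞 ℚ)).symm ⟨p, Fact.out⟩) : NumberField.Place ℚ)) :=
          inferInstanceAs (TopologicalSpace (((Rat.HeightOneSpectrum.primesEquiv (R := 𝓞 ℚ)).symm ⟨p, Fact.out⟩).adicCompletion ℚ))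
        haveI : IsNonarchimedeanLocalField (NumberField.Place.Completion (Sum.inr ((Rat.HeightOneSpectrum.primesEquiv (R := 𝓞 ℚ)).symm ⟨p, Fact.out⟩) : NumberField.Place ℚ)) :=
          inferInstanceAs (IsNonarchimedeanLocalField (((Rat.HeightOneSpectrum.primesEquiv (R := 𝓞 ℚ)).symm ⟨p, Fact.out⟩).adicCompletion ℚ))
        haveI : CharZero (NumberField.Place.Completion (Sum.inr ((Rat.HeightOneSpectrum.primesEquiv (R := 𝓞 ℚ)).symm ⟨p, Fact.out⟩) : NumberField.Place ℚ)) := LocalField.charZero_adicCompletion ((Rat.HeightOneSpectrum.primesEquiv (R := 𝓞 ℚ)).symm ⟨p, Fact.out⟩)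
        letI : Algebra ℚ_[p] (NumberField.Place.Completion (Sum.inr ((Rat.HeightOneSpectrum.primesEquiv (R := 𝓞 ℚ)).symm ⟨p, Fact.out⟩) : NumberField.Place ℚ)) :=
          LocalField.adicCompletionPadicAlgebra ((Rat.HeightOneSpectrum.primesEquiv (R := 𝓞 ℚ)).symm ⟨p, Fact.out⟩) p ((natCast_mem_asIdeal_iff_eq_primesEquiv_symm _ (Fact.out : p.Prime)).mpr rfl)
        haveI : Fact (¬ IsUnit ((p : ℕ) : integerC (NumberField.Place.Completion (Sum.inr ((Rat.HeightOneSpectrum.primesEquiv (R := 𝓞 ℚ)).symm ⟨p, Fact.out⟩) : NumberField.Place ℚ)))) :=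
          ⟨not_isUnit_natCast_integerC (show valuation (NumberField.Place.Completion (Sum.inr ((Rat.HeightOneSpectrum.primesEquiv (R := 𝓞 ℚ)).symm ⟨p, Fact.out⟩) : NumberField.Place ℚ)) ((p : ℕ) : (NumberField.Place.Completion (Sum.inr ((Rat.HeightOneSpectrum.primesEquiv (R := 𝓞 ℚ)).symm ⟨p, Fact.out⟩) : NumberField.Place ℚ))) < 1 from LocalField.valuation_adicCompletion_natCast_lt_one ((Rat.HeightOneSpectrum.primesEquiv (R := 𝓞 ℚ)).symm ⟨p, Fact.out⟩) p ((natCast_mem_asIdeal_iff_eq_primesEquiv_symm _ (Fact.out : p.Prime)).mpr rfl))⟩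
        haveI := isAdicComplete_integerC_natCast (show valuation (NumberField.Place.Completion (Sum.inr ((Rat.HeightOneSpectrum.primesEquiv (R := 𝓞 ℚ)).symm ⟨p, Fact.out⟩) : NumberField.Place ℚ)) ((p : ℕ) : (NumberField.Place.Completion (Sum.inr ((Rat.HeightOneSpectrum.primesEquiv (R := 𝓞 ℚ)).symm ⟨p, Fact.out⟩) : NumberField.Place ℚ))) < 1 from LocalField.valuation_adicCompletion_natCast_lt_one ((Rat.HeightOneSpectrum.primesEquiv (R := 𝓞 ℚ)).symm ⟨p, Fact.out⟩) p ((natCast_mem_asIdeal_iff_eq_primesEquiv_symm _ (Fact.out : p.Prime)).mpr rfl))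
        ∃ (d₀ : (bdRPeriodRingData (show valuation (NumberField.Place.Completion (Sum.inr ((Rat.HeightOneSpectrum.primesEquiv (R := 𝓞 ℚ)).symm ⟨p, Fact.out⟩) : NumberField.Place ℚ)) ((p : ℕ) : (NumberField.Place.Completion (Sum.inr ((Rat.HeightOneSpectrum.primesEquiv (R := 𝓞 ℚ)).symm ⟨p, Fact.out⟩) : NumberField.Place ℚ))) < 1 from LocalField.valuation_adicCompletion_natCast_lt_one ((Rat.HeightOneSpectrum.primesEquiv (R := 𝓞 ℚ)).symm ⟨p, Fact.out⟩) p ((natCast_mem_asIdeal_iff_eq_primesEquiv_symm _ (Fact.out : p.Prime)).mpr rfl))).FilZeroLine ρV),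

          -- (PIN) the Néron range of `exp*_{d₀}` on `H¹(ℚ_v, T_pW_K)` (reading 1: Tate duality, [BK90] 3.8 / Kato II 1.4.1),
          -- for EVERY compatible `ℝ≥0`-valuation `wv` with `W_K ⊗ ℚ_v` integral (all such give the same `log_ω`; the
          -- RHS is the right-hand side of `PAdicHodge.exists_smul_range_expStarCoord_iff_trace_log` at `F = ℚ_v`, `e = 1`)
          (∀ (wv : Valuation (NumberField.Place.Completion (Sum.inr ((Rat.HeightOneSpectrum.primesEquiv (R := 𝓞 ℚ)).symm ⟨p, Fact.out⟩) : NumberField.Place ℚ)) ℝ≥0) [wv.Compatible] [(W'.baseChange (NumberField.Place.Completion (Sum.inr ((Rat.HeightOneSpectrum.primesEquiv (R := 𝓞 ℚ)).symm ⟨p, Fact.out⟩) : NumberField.Place ℚ))).IsIntegral wv.integer],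
            ∀ a : (NumberField.Place.Completion (Sum.inr ((Rat.HeightOneSpectrum.primesEquiv (R := 𝓞 ℚ)).symm ⟨p, Fact.out⟩) : NumberField.Place ℚ)),
              (∃ η : contOneCocycles ρT.toTopRep, expStarCoord W' (show valuation (NumberField.Place.Completion (Sum.inr ((Rat.HeightOneSpectrum.primesEquiv (R := 𝓞 ℚ)).symm ⟨p, Fact.out⟩) : NumberField.Place ℚ)) ((p : ℕ) : (NumberField.Place.Completion (Sum.inr ((Rat.HeightOneSpectrum.primesEquiv (R := 𝓞 ℚ)).symm ⟨p, Fact.out⟩) : NumberField.Place ℚ))) < 1 from LocalField.valuation_adicCompletion_natCast_lt_one ((Rat.HeightOneSpectrum.primesEquiv (R := 𝓞 ℚ)).symm ⟨p, Fact.out⟩) p ((natCast_mem_asIdeal_iff_eq_primesEquiv_symm _ (Fact.out : p.Prime)).mpr rfl)) d₀ η = a) ↔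
                ∀ P : (W'.baseChange (NumberField.Place.Completion (Sum.inr ((Rat.HeightOneSpectrum.primesEquiv (R := 𝓞 ℚ)).symm ⟨p, Fact.out⟩) : NumberField.Place ℚ))).toAffine.Point,
                  ‖Algebra.trace ℚ_[p] (NumberField.Place.Completion (Sum.inr ((Rat.HeightOneSpectrum.primesEquiv (R := 𝓞 ℚ)).symm ⟨p, Fact.out⟩) : NumberField.Place ℚ))
                      (a * FormalGroupChart.padicLogPointFiniteExt wv (W'.baseChange (NumberField.Place.Completion (Sum.inr ((Rat.HeightOneSpectrum.primesEquiv (R := 𝓞 ℚ)).symm ⟨p, Fact.out⟩) : NumberField.Place ℚ))) p P)‖ ≤ 1) ∧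

          -- (N) Manin-symbol coordinates, Thm 13.6: for `p ≠ 2`, a `p`-adic unit among the `n ξ ±` of each sign
          ∃ (n : SL(2, ℤ) → Bool → ℚ),
            (p ≠ 2 → ∀ b : Bool, ∃ ξ : SL(2, ℤ), n ξ b ≠ 0 ∧ padicValRat p (n ξ b) = 0) ∧
            ∀ (m : ℕ) [NeZero m],
              ∃ (ι : CyclotomicField m ℚ →+* ℂ)
                (Λ : H1 (tateRep W' p) (Literature.NumberTheory.GaloisRepresentations.rootsOfUnityFixer ℚ m) →ₗ[ℤ_[p]]
                  ℚ_[p] ⊗[ℚ] CyclotomicField m ℚ),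
            (∀ (Ψ : ℚ_[p] ⊗[ℚ] CyclotomicField m ℚ ≃ₐ[ℚ]
                (Π w : ((Rat.HeightOneSpectrum.primesEquiv (R := 𝓞 ℚ)).symm ⟨p, Fact.out⟩).Extension
                  (𝓞 (CyclotomicField m ℚ)), w.1.adicCompletion (CyclotomicField m ℚ)))
              (hΨ : ∀ (s : ℚ_[p]) (x : CyclotomicField m ℚ)
                (w : ((Rat.HeightOneSpectrum.primesEquiv (R := 𝓞 ℚ)).symm ⟨p, Fact.out⟩).Extension
                  (𝓞 (CyclotomicField m ℚ))),
                Ψ (s ⊗ₜ[ℚ] x) w =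
                  algebraMap (CyclotomicField m ℚ) (w.1.adicCompletion (CyclotomicField m ℚ)) x *
                  algebraMap (((Rat.HeightOneSpectrum.primesEquiv (R := 𝓞 ℚ)).symm ⟨p, Fact.out⟩).adicCompletion ℚ)
                    (w.1.adicCompletion (CyclotomicField m ℚ)) ((Padic.adicCompletionEquiv (𝓞 ℚ) ⟨p, Fact.out⟩) s)),
              ∀ (w : ((Rat.HeightOneSpectrum.primesEquiv (R := 𝓞 ℚ)).symm ⟨p, Fact.out⟩).Extension
                  (𝓞 (CyclotomicField m ℚ))),
                  -- the (propositionally unique) local-field structure proofs at `L_{w}` are QUANTIFIED, so that a consumer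
                  -- instantiates them with its own terms (no definitional unfolding is then asked of the kernel)
                  ∀ (hw : ((p : ℕ) : 𝓞 (CyclotomicField m ℚ)) ∈ w.1.asIdeal)
                    [CharZero (w.1.adicCompletion (CyclotomicField m ℚ))]
                    [Fact (¬ IsUnit ((p : ℕ) : integerC (w.1.adicCompletion (CyclotomicField m ℚ))))]
                    [IsAdicComplete (Ideal.span {((p : ℕ) : integerC (w.1.adicCompletion (CyclotomicField m ℚ)))}) (integerC (w.1.adicCompletion (CyclotomicField m ℚ)))]
                    (hL : valuation (w.1.adicCompletion (CyclotomicField m ℚ)) ((p : ℕ) : (w.1.adicCompletion (CyclotomicField m ℚ))) < 1),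
                  letI := LocalField.adicCompletionPadicAlgebra w.1 p hw
                  -- the rational tower representation `V_pW|_{Γ_ℚ_v}|_{Γ_{L_w}}`, restricted along the COMPOSITE
                  -- `Γ_{L_w} → Γ_{ℚ_v} → Γ_ℚ` (= `ρV.restrict _` by `ContinuousRep.restrict_comp`, a definitional equality)
                  letI ρVT := (W'.rationalTateGaloisRep p (W'.continuous_rationalGaloisRepTate_holds p)).restrict
                    ((absGaloisRestrict ℚ (NumberField.Place.Completion (Sum.inr ((Rat.HeightOneSpectrum.primesEquiv (R := 𝓞 ℚ)).symm ⟨p, Fact.out⟩) : NumberField.Place ℚ))).comp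
                      (absGaloisRestrict (((Rat.HeightOneSpectrum.primesEquiv (R := 𝓞 ℚ)).symm ⟨p, Fact.out⟩).adicCompletion ℚ) (w.1.adicCompletion (CyclotomicField m ℚ))))
                  ∃ (dw : (bdRPeriodRingData hL).FilZeroLine ρVT),
                    (∀ (η₀ : contOneCocycles ρT.toTopRep)
                      (η : contOneCocycles (ρT.restrict (absGaloisRestrict (((Rat.HeightOneSpectrum.primesEquiv (R := 𝓞 ℚ)).symm ⟨p, Fact.out⟩).adicCompletion ℚ) (w.1.adicCompletion (CyclotomicField m ℚ)))).toTopRep),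
                      (∀ σ, η.1 σ = η₀.1 (absGaloisRestrict (((Rat.HeightOneSpectrum.primesEquiv (R := 𝓞 ℚ)).symm ⟨p, Fact.out⟩).adicCompletion ℚ) (w.1.adicCompletion (CyclotomicField m ℚ)) σ)) →
                      (bdRPeriodRingData hL).dualExpCoord
                          (logCyclotomic p) ρVT dw.ω (fun σ => TateModule.toRational p (η.1 σ)) =
                        algebraMap (((Rat.HeightOneSpectrum.primesEquiv (R := 𝓞 ℚ)).symm ⟨p, Fact.out⟩).adicCompletion ℚ) (w.1.adicCompletion (CyclotomicField m ℚ))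
                          (expStarCoord W' (show valuation (NumberField.Place.Completion (Sum.inr ((Rat.HeightOneSpectrum.primesEquiv (R := 𝓞 ℚ)).symm ⟨p, Fact.out⟩) : NumberField.Place ℚ)) ((p : ℕ) : (NumberField.Place.Completion (Sum.inr ((Rat.HeightOneSpectrum.primesEquiv (R := 𝓞 ℚ)).symm ⟨p, Fact.out⟩) : NumberField.Place ℚ))) < 1 from LocalField.valuation_adicCompletion_natCast_lt_one ((Rat.HeightOneSpectrum.primesEquiv (R := 𝓞 ℚ)).symm ⟨p, Fact.out⟩) p ((natCast_mem_asIdeal_iff_eq_primesEquiv_symm _ (Fact.out : p.Prime)).mpr rfl)) d₀ η₀ : (NumberField.Place.Completion (Sum.inr ((Rat.HeightOneSpectrum.primesEquiv (R := 𝓞 ℚ)).symm ⟨p, Fact.out⟩) : NumberField.Place ℚ)))) ∧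
                    (∀ (y : H1 (tateRep W' p) (Literature.NumberTheory.GaloisRepresentations.rootsOfUnityFixer ℚ m))
                    (φ'' : contOneCocycles (subgroupRep (tateRep W' p).toTopRep (Literature.NumberTheory.GaloisRepresentations.rootsOfUnityFixer ℚ m)))
                    (ψT : contOneCocycles (ρT.restrict
                      (absGaloisRestrict (((Rat.HeightOneSpectrum.primesEquiv (R := 𝓞 ℚ)).symm ⟨p, Fact.out⟩).adicCompletion ℚ) (w.1.adicCompletion (CyclotomicField m ℚ)))).toTopRep),
                    oneCocycleClass _ φ'' = y →
                    (∀ σ (hσ : absGaloisRestrictTower ℚ (((Rat.HeightOneSpectrum.primesEquiv (R := 𝓞 ℚ)).symm ⟨p, Fact.out⟩).adicCompletion ℚ) (w.1.adicCompletion (CyclotomicField m ℚ)) σ ∈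
                        Literature.NumberTheory.GaloisRepresentations.rootsOfUnityFixer ℚ m),
                      ψT.1 σ = φ''.1 ⟨absGaloisRestrictTower ℚ (((Rat.HeightOneSpectrum.primesEquiv (R := 𝓞 ℚ)).symm ⟨p, Fact.out⟩).adicCompletion ℚ) (w.1.adicCompletion (CyclotomicField m ℚ)) σ, hσ⟩) →
                    Ψ (Λ y) w =
                      (bdRPeriodRingData hL).dualExpCoord
                        (logCyclotomic p) ρVT dw.ω (fun σ => TateModule.toRational p (ψT.1 σ)))) ∧

                -- (8.1.3) classes, (C4) rationality (Thm 9.7), (C5′) value law (Thm 9.7 ∘ Thm 6.6 (1), SL₂(ℤ) case)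
                ∀ (c d : ℤ) (ξ : SL(2, ℤ)), c ≡ 1 [ZMOD (N : ℤ)] → d ≡ 1 [ZMOD (N : ℤ)] →
                  Int.gcd (c * d) (6 * p * m) = 1 →
                  ∃ (z : H1 (tateRep W' p) (Literature.NumberTheory.GaloisRepresentations.rootsOfUnityFixer ℚ m))
                    (x : CyclotomicField m ℚ),
                    Λ z = (1 : ℚ_[p]) ⊗ₜ[ℚ] x ∧
                    ∀ (χ : DirichletCharacter ℂ m) (Lχ : ℂ → ℂ), IsDepletedTwistedL f m (p * N) χ Lχ →
                      (χ (-1) = 1 →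
                        charSum m ι χ x =
                          (((c : ℂ) ^ 2 - (c : ℂ) * χ (c : ZMod m)) * ((d : ℂ) ^ 2 - (d : ℂ) * (χ (d : ZMod m))⁻¹)) *
                            ((n ξ true : ℚ) : ℂ) * (Lχ 1 / (W'.realPeriodRat : ℂ))) ∧
                      (χ (-1) = -1 →
                        charSum m ι χ x =
                          (((c : ℂ) ^ 2 - (c : ℂ) * χ (c : ZMod m)) * ((d : ℂ) ^ 2 - (d : ℂ) * (χ (d : ZMod m))⁻¹)) *
                            ((n ξ false : ℚ) : ℂ) * (Lχ 1 / (Complex.I * (W'.imaginaryPeriodRat : ℂ))))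

-- TODO(general form): Kato (8.1.3)/9.7/6.6 (1) for newforms of weight `k ≥ 2` with coefficients (`F ≠ ℚ`,
-- `T = V_{O_λ}(f)(k − r)`, `1 ≤ r′ ≤ k − 1`), the `a(A)`-type value law in the same Néron coordinate, and the member
-- NAMED once `V_{ℤ_p}(f)` (the image of `H¹_ét(Y₁(N) ⊗ ℚ̄, ℤ_p)`) is an object of the tree.

end Literature.NumberTheory.EllipticCurves.Kato2004

end PartA

/-! ## PART B — the FINAL ASSEMBLY (to be proposed once P1 is importable) -/

open scoped MatrixGroups ModularForm Classical NumberField TensorProduct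
open CongruenceSubgroup WeierstrassCurve IsDedekindDomain NumberField
open Literature.NumberTheory.GaloisRepresentations
open Literature.NumberTheory.EllipticCurves Literature.NumberTheory.EllipticCurves.ModularForms
open Literature.NumberTheory.EllipticCurves.Kato2004 Literature.NumberTheory.EllipticCurves.Kato2004.EulerSystemValues
open Literature.NumberTheory.EllipticCurves.Rank1Residual

namespace Summit.BirchSwinnertonDyer.BirchSwinnertonDyer.Theorems.KatoAssemblySocket

/-- `gcd(m, pN) = 1 ⟹ p ∤ m` for a prime `p`. [folklore] -/
theorem not_dvd_of_coprime_mul {p N m : ℕ} [hp : Fact p.Prime] (h : m.Coprime (p * N)) : ¬ p ∣ m := by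
  intro hpm
  have h1 : p ∣ Nat.gcd m (p * N) := Nat.dvd_gcd hpm (dvd_mul_right p N)
  rw [h, Nat.dvd_one] at h1
  exact hp.out.ne_one h1

set_option backward.isDefEq.respectTransparency false in
/-- ★★★ **THE FINAL ASSEMBLY: F″ ⟸ P1 + (S5b-tower) + [Kato II 1.2.3] + [de Rham]** (Carayol-free: via
`KatoCarayolFree.kato_neron_five_le_of_integralSL2NeronValues'`, p603961).
Kato's Néron-twisted integrality `kato_neron_isIntegral_twistedSymbolSum_of_additive_five_le` (the ONE stub of K★'s
registered skeleton, and the binder of TDS57 / KP57 / AKR #7) follows from the cite-only facts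
`exists_member_sl2ZetaElement_neron_values` (P1: Kato (8.1.3) + Thm. 9.7 + Thm. 6.6 (1) + Thm. 13.6 at Kato's member,
Néron-pinned; p603032), (S5b-tower) `exists_smul_range_expStarCoord_tower_iff_trace_log`, the Prop-1.2.3 / de Rham
facts `cupLogInjective_and_hasDualExp_of_isDeRham`, `isDeRham_restrictedRationalTateRep` —
by `KatoCarayolFree.kato_neron_five_le_of_integralSL2NeronValues'` (p603961, the Carayol-free twin of p602985) fed with P1's data, the semi-local isomorphism of
`AdelicBaseChange.exists_padicTensorAlgEquiv`, and P4-coh (`SemiLocalIntegrality.semilocal_mem_adicCompletionIntegers_of_pin_of_semi`,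
seat edix-p3 g4) for the integrality clause.
[cite: Kato2004Asterisque, (8.1.3) (p. 180), §8.3 (p. 181), Thm. 9.7 (p. 189), Thm. 6.6 (1) (p. 163), Thm. 13.6 (p. 227)]
[cite: Kato1993LNM1553, Ch. II §1.2.4 and Thm. 1.4.1 (3)-(4)] [cite: BlochKato1990, Prop. 3.8 and Example 3.11]
[cite: KimNakamura2020, Cor. 2.4] -/
theorem kato_neron_five_le_of_sl2NeronValues
    (hT₂ : Literature.NumberTheory.PAdicHodge.exists_smul_range_expStarCoord_tower_iff_trace_log)
    (hP : Literature.NumberTheory.PAdicHodge.cupLogInjective_and_hasDualExp_of_isDeRham)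
    (hDR : Literature.NumberTheory.PAdicHodge.isDeRham_restrictedRationalTateRep)
    (hP1 : exists_member_sl2ZetaElement_neron_values) :
    kato_neron_isIntegral_twistedSymbolSum_of_additive_five_le := by
  refine KatoCarayolFree.kato_neron_five_le_of_integralSL2NeronValues' fun W _ p _ ↦ ?_
  obtain ⟨W', hE, hM, hiso, h⟩ := hP1 W p
  refine ⟨W', hE, hM, hiso, ?_⟩
  intro _ _ _ N _ f hf
  obtain ⟨d₀, hPIN, n, hN, hm⟩ := h f hf
  refine ⟨n, hN, fun m _ ↦ ?_⟩
  obtain ⟨ι, Λ, hSEMI, hVAL⟩ := hm m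
  obtain ⟨Ψ, hΨ⟩ := Literature.NumberTheory.AdelicBaseChange.exists_padicTensorAlgEquiv (CyclotomicField m ℚ) p
  refine ⟨ι, Λ, Ψ, hΨ, fun hp5 hg hmu hcop hcl y w ↦ ?_, hVAL⟩
  have hadd : Addv W' p := ⟨hg, hmu⟩
  have hpm : ¬ p ∣ m := not_dvd_of_coprime_mul hcop
  have hSEMI' := hSEMI Ψ hΨ
  sorry

end Summit.BirchSwinnertonDyer.BirchSwinnertonDyer.Theorems.KatoAssemblySocket

end
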